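import Summits.RiemannHypothesis.RiemannHypothesis.Theorems.SignConeConeMagnificationCombTypeNorm

/-!
# Crux `SignCone.SlackDesign` (stmt-RiemannHypothesis-18009), line `real_comb_type`, stub `stub_combNormAsymp`:
# the `c`-free norm asymptotic `Σ_{ℓ,ℓ'} α_ℓ α_ℓ' V_M(ℓ,ℓ',1) / log M → (∫ b²)·Φ_α(1)`

For a real design `α` on `[1, L]` (`L ≥ 1`) and a smooth real bump `b ≥ 0` supported in `[-1,1]`, the node form of
the squared norm of the `ζ`-mollified two-scale comb with window `h = √(log M)/M`,
`Σ_{ℓ,ℓ' ≤ L} α_ℓ α_ℓ' V_M(ℓ,ℓ',1)`, `V_M(ℓ,ℓ',1) = Σ_{k' ≤ M} Σ_{k ≤ M} B((log(ℓ'k'/ℓ) − log k)/h)/√(kk')`,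
`B(v) = ∫ b(u) b(u − v) du`, divided by `log M`, tends to `(∫ b²)·Φ_α(1)` with
`Φ_α(1) = Σ_{ℓ,ℓ'} α_ℓ α_ℓ' gcd(ℓ',ℓ)/√(ℓℓ')` (written, as in the crux, as the real part of the complex gcd form).

This is bookkeeping over the landed norm node `CombType.norm_node_eval`
(`|V_M(ℓ,ℓ',1) − (∫ b²)(gcd(ℓ',ℓ)/√(ℓℓ')) log M| ≤ C_n √(log M)` for `M ≥ 4096 L²`, `1 ≤ ℓ, ℓ' ≤ L`): summing over
the `L²` pairs with the weights `α_ℓ α_ℓ'` and dividing by `log M` leaves an error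
`≤ (Σ_{ℓ,ℓ'} |α_ℓ α_ℓ'|)·|C_n| / √(log M) → 0`.

* `tendsto_sum_div_log_of_node_bounds` — the abstract bookkeeping step (any node values `V`, weights `g`).
* `phi_one_summand_re` — the complex gcd-form summand at `n = 1` is the real number `α_ℓ α_ℓ' gcd(ℓ',ℓ)/√(ℓℓ')`.
* `combNormAsymp` — the norm asymptotic, curried.
* `stub_combNormAsymp` — the registered stub of the line skeleton, verbatim (uncurried `∀`-form).
-/

noncomputable section

-- `Summit.RiemannHypothesis.RiemannHypothesis.…` repeats a namespace component by design (D-0017 layout).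
set_option linter.dupNamespace false

open scoped BigOperators ComplexConjugate Topology
open MeasureTheory Set Filter
open Literature.NumberTheory.LFunctions
open Summit.RiemannHypothesis.RiemannHypothesis.Theorems.SignConeConeMagnification

namespace Summit.RiemannHypothesis.RiemannHypothesis.Theorems.SignConeSlackDesign

/-- `K / √(log M) → 0` as `M → ∞` through `ℕ`. [folklore] -/
theorem tendsto_const_div_sqrt_log (K : ℝ) :
    Tendsto (fun M : ℕ => K / Real.sqrt (Real.log M)) atTop (𝓝 0) :=
  tendsto_const_nhds.div_atTop
    (Real.tendsto_sqrt_atTop.comp (Real.tendsto_log_atTop.comp tendsto_natCast_atTop_atTop))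

/-- **Bookkeeping.**  If node values `V M ℓ ℓ'` satisfy `|V M ℓ ℓ' − B₀ g(ℓ,ℓ') log M| ≤ C_n √(log M)` for all
`M ≥ M₀` and `1 ≤ ℓ, ℓ' ≤ L`, then `Σ_{ℓ,ℓ' ≤ L} α_ℓ α_ℓ' V M ℓ ℓ' / log M → B₀ Σ_{ℓ,ℓ'} α_ℓ α_ℓ' g(ℓ,ℓ')`:
the error is at most `(Σ |α_ℓ α_ℓ'|)·|C_n|/√(log M)`. [folklore] -/
theorem tendsto_sum_div_log_of_node_bounds {L M₀ : ℕ} {α : ℕ → ℝ} {V : ℕ → ℕ → ℕ → ℝ} {g : ℕ → ℕ → ℝ}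
    {B₀ Cn : ℝ}
    (hV : ∀ M : ℕ, M₀ ≤ M → ∀ ℓ ∈ Finset.Icc 1 L, ∀ ℓ' ∈ Finset.Icc 1 L,
      |V M ℓ ℓ' - B₀ * g ℓ ℓ' * Real.log M| ≤ Cn * Real.sqrt (Real.log M)) :
    Tendsto (fun M : ℕ => (∑ ℓ ∈ Finset.Icc 1 L, ∑ ℓ' ∈ Finset.Icc 1 L, α ℓ * α ℓ' * V M ℓ ℓ') / Real.log M)
      atTop (𝓝 (B₀ * ∑ ℓ ∈ Finset.Icc 1 L, ∑ ℓ' ∈ Finset.Icc 1 L, α ℓ * α ℓ' * g ℓ ℓ')) := by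
  set A : ℝ := ∑ ℓ ∈ Finset.Icc 1 L, ∑ ℓ' ∈ Finset.Icc 1 L, |α ℓ * α ℓ'| with hA
  set Φ : ℝ := ∑ ℓ ∈ Finset.Icc 1 L, ∑ ℓ' ∈ Finset.Icc 1 L, α ℓ * α ℓ' * g ℓ ℓ' with hΦ
  rw [tendsto_iff_norm_sub_tendsto_zero]
  refine squeeze_zero' (Eventually.of_forall fun _ => norm_nonneg _) ?_
    (tendsto_const_div_sqrt_log (A * |Cn|))
  filter_upwards [eventually_ge_atTop M₀, eventually_ge_atTop 2] with M hM hM2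
  rw [Real.norm_eq_abs]
  have hlog : 0 < Real.log (M : ℝ) := Real.log_pos (by exact_mod_cast hM2)
  have hsq : 0 < Real.sqrt (Real.log M) := Real.sqrt_pos.2 hlog
  have hsq2 : Real.sqrt (Real.log M) * Real.sqrt (Real.log M) = Real.log M := Real.mul_self_sqrt hlog.le
  -- the difference is one weighted sum of the node errors, divided by `log M`
  have key : (∑ ℓ ∈ Finset.Icc 1 L, ∑ ℓ' ∈ Finset.Icc 1 L, α ℓ * α ℓ' * V M ℓ ℓ') / Real.log M - B₀ * Φ =
      (∑ ℓ ∈ Finset.Icc 1 L, ∑ ℓ' ∈ Finset.Icc 1 L, α ℓ * α ℓ' * (V M ℓ ℓ' - B₀ * g ℓ ℓ' * Real.log M)) /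
        Real.log M := by
    rw [eq_div_iff hlog.ne', sub_mul, div_mul_cancel₀ _ hlog.ne', hΦ, Finset.mul_sum, Finset.sum_mul,
      ← Finset.sum_sub_distrib]
    refine Finset.sum_congr rfl fun ℓ _ => ?_
    rw [Finset.mul_sum, Finset.sum_mul, ← Finset.sum_sub_distrib]
    refine Finset.sum_congr rfl fun ℓ' _ => ?_
    ring
  -- the weighted sum of the node errors is `≤ A |C_n| √(log M)`
  have hsum : |∑ ℓ ∈ Finset.Icc 1 L, ∑ ℓ' ∈ Finset.Icc 1 L, α ℓ * α ℓ' * (V M ℓ ℓ' - B₀ * g ℓ ℓ' * Real.log M)| ≤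
      A * |Cn| * Real.sqrt (Real.log M) := by
    rw [hA, Finset.sum_mul, Finset.sum_mul]
    refine (Finset.abs_sum_le_sum_abs _ _).trans (Finset.sum_le_sum fun ℓ hℓ => ?_)
    rw [Finset.sum_mul, Finset.sum_mul]
    refine (Finset.abs_sum_le_sum_abs _ _).trans (Finset.sum_le_sum fun ℓ' hℓ' => ?_)
    have h1 : |V M ℓ ℓ' - B₀ * g ℓ ℓ' * Real.log M| ≤ |Cn| * Real.sqrt (Real.log M) :=
      (hV M hM ℓ hℓ ℓ' hℓ').trans (mul_le_mul_of_nonneg_right (le_abs_self _) hsq.le)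
    rw [abs_mul, mul_assoc |α ℓ * α ℓ'|]
    exact mul_le_mul_of_nonneg_left h1 (abs_nonneg _)
  rw [key, abs_div, abs_of_pos hlog, div_le_div_iff₀ hlog hsq]
  calc |∑ ℓ ∈ Finset.Icc 1 L, ∑ ℓ' ∈ Finset.Icc 1 L, α ℓ * α ℓ' * (V M ℓ ℓ' - B₀ * g ℓ ℓ' * Real.log M)| *
        Real.sqrt (Real.log M)
        ≤ A * |Cn| * Real.sqrt (Real.log M) * Real.sqrt (Real.log M) := mul_le_mul_of_nonneg_right hsum hsq.le
    _ = A * |Cn| * Real.log M := by rw [mul_assoc, hsq2]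

/-- The summand of the complex gcd form `Φ_α(n)` at `n = 1` for a real design `α` is the real number
`α_ℓ α_ℓ' gcd(ℓ',ℓ)/√(ℓℓ')`. [folklore] -/
theorem phi_one_summand_re (a a' : ℝ) (ℓ ℓ' : ℕ) :
    ((a : ℂ) * conj (a' : ℂ) * (((Nat.gcd (1 * ℓ') ℓ : ℕ) : ℝ) : ℂ) / (Real.sqrt ((ℓ : ℝ) * ℓ') : ℂ)).re =
      a * a' * ((Nat.gcd ℓ' ℓ : ℝ) / Real.sqrt ((ℓ : ℝ) * ℓ')) := by
  rw [Complex.conj_ofReal, one_mul, ← Complex.ofReal_mul, ← Complex.ofReal_mul, ← Complex.ofReal_div,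
    Complex.ofReal_re]
  ring

/-- **The norm asymptotic** (curried form of the stub).  For a real design `α` on `[1, L]`, `L ≥ 1`, and a smooth
real bump `b ≥ 0` supported in `[-1,1]`:
`Σ_{ℓ,ℓ' ≤ L} α_ℓ α_ℓ' V_M(ℓ,ℓ',1) / log M → (∫ b²)·Φ_α(1)` as `M → ∞`, where
`V_M(ℓ,ℓ',1) = Σ_{k' ≤ M} Σ_{k ≤ M} B((log(ℓ'k'/ℓ) − log k)/h)/√(kk')`, `B(v) = ∫ b(u)b(u−v)du`, `h = √(log M)/M`,
and `Φ_α(1) = Re Σ α_ℓ conj(α_ℓ') gcd(1·ℓ',ℓ)/√(ℓℓ')`. [folklore] -/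
theorem combNormAsymp (α : ℕ → ℝ) {L : ℕ} (hL : 1 ≤ L) {b : ℝ → ℝ} (hb : ContDiff ℝ (⊤ : ℕ∞) b)
    (hbc : HasCompactSupport b) (hbs : tsupport b ⊆ Icc (-1) 1) (hb0 : ∀ x, 0 ≤ b x) :
    Tendsto (fun M : ℕ =>
      (∑ ℓ ∈ Finset.Icc 1 L, ∑ ℓ' ∈ Finset.Icc 1 L, α ℓ * α ℓ' *
          ∑ k' ∈ Finset.Icc 1 M,
            (∑ k ∈ Finset.Icc 1 M, (∫ u, b u * b (u - (Real.log (((1 : ℕ) : ℝ) * ℓ' * k' / ℓ) - Real.log k)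
                / (Real.sqrt (Real.log M) / M))) / Real.sqrt k) / Real.sqrt k' / Real.sqrt ((1 : ℕ) : ℝ)) /
        Real.log M)
      atTop
      (𝓝 ((∫ u, b u ^ 2) *
        (∑ ℓ ∈ Finset.Icc 1 L, ∑ ℓ' ∈ Finset.Icc 1 L, ((α ℓ : ℝ) : ℂ) * conj ((α ℓ' : ℝ) : ℂ) *
            (((Nat.gcd (1 * ℓ') ℓ : ℕ) : ℝ) : ℂ) / (Real.sqrt ((ℓ : ℝ) * ℓ') : ℂ)).re)) := by
  obtain ⟨Cn, hCn⟩ := CombType.norm_node_eval hb hbc hbs hb0 hL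
  simp_rw [Complex.re_sum, phi_one_summand_re]
  exact tendsto_sum_div_log_of_node_bounds (α := α)
    (V := fun M ℓ ℓ' => ∑ k' ∈ Finset.Icc 1 M,
      (∑ k ∈ Finset.Icc 1 M, (∫ u, b u * b (u - (Real.log (((1 : ℕ) : ℝ) * ℓ' * k' / ℓ) - Real.log k)
          / (Real.sqrt (Real.log M) / M))) / Real.sqrt k) / Real.sqrt k' / Real.sqrt ((1 : ℕ) : ℝ))
    (g := fun ℓ ℓ' => (Nat.gcd ℓ' ℓ : ℝ) / Real.sqrt ((ℓ : ℝ) * ℓ')) (B₀ := ∫ x, b x ^ 2) hCn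

/-- **Stub N — `combNormAsymp`** (registered stub of the line `real_comb_type` of the crux `SignCone.SlackDesign`,
verbatim).  For a real design `α` on `[1, L]` and a smooth real bump `b ≥ 0` supported in `[-1,1]`, the squared
norm of the `ζ`-mollified comb in node form, `Σ_{ℓ,ℓ'} α_ℓ α_ℓ' V_{ℓℓ'}(1)` (window `√(log M)/M`), is
`(∫ b²)·Φ_α(1)·log M·(1 + o(1))`, `Φ_α(1) = Σ α_ℓ α_ℓ' gcd(ℓ',ℓ)/√(ℓℓ')`. [folklore] -/
theorem stub_combNormAsymp :
    ∀ α : ℕ → ℝ, ∀ L : ℕ, (∀ m, L < m → α m = 0) → 1 ≤ L →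
    ∀ b : ℝ → ℝ, ContDiff ℝ (⊤ : ℕ∞) b → HasCompactSupport b → tsupport b ⊆ Set.Icc (-1) 1 → (∀ x, 0 ≤ b x) →
    Filter.Tendsto (fun M : ℕ =>
      (∑ ℓ ∈ Finset.Icc 1 L, ∑ ℓ' ∈ Finset.Icc 1 L, α ℓ * α ℓ' *
          ∑ k' ∈ Finset.Icc 1 M,
            (∑ k ∈ Finset.Icc 1 M, (∫ u, b u * b (u - (Real.log (((1 : ℕ) : ℝ) * ℓ' * k' / ℓ) - Real.log k)
                / (Real.sqrt (Real.log M) / M))) / Real.sqrt k) / Real.sqrt k' / Real.sqrt ((1 : ℕ) : ℝ)) /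
        Real.log M)
      Filter.atTop
      (nhds ((∫ u, b u ^ 2) *
        (∑ ℓ ∈ Finset.Icc 1 L, ∑ ℓ' ∈ Finset.Icc 1 L, ((α ℓ : ℝ) : ℂ) * (starRingEnd ℂ) ((α ℓ' : ℝ) : ℂ) *
            (((Nat.gcd (1 * ℓ') ℓ : ℕ) : ℝ) : ℂ) / (Real.sqrt ((ℓ : ℝ) * ℓ') : ℂ)).re)) :=
  fun α _ _ hL _ hb hbc hbs hb0 => combNormAsymp α hL hb hbc hbs hb0

end Summit.RiemannHypothesis.RiemannHypothesis.Theorems.SignConeSlackDesign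

end
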